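import Literature.AlgebraicGeometry.HodgeTheory.HodgeConjecture
import Literature.AlgebraicGeometry.HodgeTheory.HodgeFiltration
import HarnessLib

/-!
# Smooth projective complex varieties have Hodge models

Family `hodge`, layer `Literature/AlgebraicGeometry/HodgeTheory`. Companion to
`RationalHodgeClasses` (the structure `HodgeTheory.HodgeModel n X`) and `HodgeConjecture`
(whose first conjunct is `Nonempty (HodgeModel n X)`, "a THEOREM (Serre, GAGA §2; de Rham 1931;
Hodge 1941 / Voisin I Thm. 6.18) … discharged once the canonical `HodgeModel` is constructed in
`Literature`"). This file gives that theorem a NAME, as a named fact (D-0014) with the hypotheses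
under which it is printed — `X` smooth projective over `ℂ` of dimension `n`
(`Literature.IsSmoothProjective n X`) — so that consumers can take `(h : nonempty_hodgeModel n X)`
instead of carrying the conjunct, and so that its discharge has a target. First consumer: the
decomposition of the barrier fact
`Literature.Barriers.HodgeConjecture.Voisin2003_generalHypersurface_noIntegralClassInF` (Voisin II,
Lemma 8.18), whose witnesses must carry a Hodge model.

## The printed ingredients (what a discharge assembles)

A `HodgeModel n X` is: a complex manifold `M` charted on a finite-dimensional `E`, Hausdorff and
σ-compact, with `φ : M → X(ℂ)` an analytification (`Literature.IsAnalytification E X n φ`), a de Rham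
comparison family natural over manifolds charted on `E`, and the Hodge decomposition of
`H^k_dR(M; ℂ)` into the `Literature.hodgePQ E M k p q`. For `X` smooth projective:

1. the analytification exists [cite: SerreGAGA1956, §2] — in the tree this is PROVED,
   `Literature.exists_isAnalytification_holds X n` (smooth of relative dimension `n`, separated, locally
   of finite type: all consequences of `IsSmoothProjective n X`);
2. `X^an` is Hausdorff and compact, hence σ-compact, because `X` is separated and proper over `ℂ`
   [cite: SGA1, Exp. XII Prop. 3.1 and Prop. 3.2];
3. a natural complex de Rham comparison family exists on manifolds charted on `ℂⁿ`
   [cite: deRham1931] [cite: WellsDACM1980, Thm. III.4.13] — the tree's named fact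
   `Literature.exists_complexDeRhamIsoFamily (Fin n → ℂ)`;
4. `X^an`, a closed complex submanifold of `ℙᴺ(ℂ)`, is Kähler (restriction of the Fubini–Study
   metric) [cite: VoisinHodgeI2002, §3.3.2], so the Hodge decomposition
   `Hᵏ(X^an, ℂ) = ⨁_{p+q=k} H^{p,q}` holds, with `H^{p,q} = K^{p,q}` the classes representable by a
   closed `(p,q)`-form (the tree's `hodgePQ`) [cite: VoisinHodgeI2002, §6.1.3 and Prop. 6.11] — the
   tree's named fact `Literature.AlgebraicGeometry.Motives.isInternal_hodgePQ` (hypotheses: compact, Hausdorff,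
   `[Literature.IsKaehlerManifold E M]`).

Assembling (1)–(4) into the structure additionally needs the real-`C^∞` structure underlying the
holomorphic atlas and the `ChartedSpace (Fin n → ℂ)` bookkeeping; none of (2)–(4) is proved in
the tree, which is why this is a named fact and not yet a theorem.

## References

* J.-P. Serre, *Géométrie algébrique et géométrie analytique*, Ann. Inst. Fourier 6 (1956), §2.
* A. Grothendieck, M. Raynaud, *SGA 1*, Exp. XII, Prop. 3.1, Prop. 3.2.
* G. de Rham (1931); R. O. Wells, *Differential Analysis on Complex Manifolds* (1980),
  Thm. III.4.13.
* C. Voisin, *Hodge Theory and Complex Algebraic Geometry I* (2002), §3.3.2 (every complex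
  projective manifold is Kähler), §6.1.3 with Prop. 6.11 (the Hodge decomposition and its
  description by closed `(p,q)`-forms), §7.1.1.
-/

noncomputable section

namespace Literature.AlgebraicGeometry.HodgeTheory

section HodgeTheory

variable {n : ℕ} {X : Motives.SchemeOver ℂ}

variable (n X) in
/-- **Smooth projective complex varieties have Hodge models** (named fact). If `X` is a smooth
projective, geometrically irreducible variety of dimension `n` over `ℂ`, then `X` has a Hodge model
`HodgeTheory.HodgeModel n X`: its analytification `X^an → X(ℂ)` (Serre), which is a compact
Hausdorff complex manifold, together with a natural complex de Rham comparison (de Rham's theorem)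
and the Hodge decomposition `Hᵏ(X^an, ℂ) = ⨁_{p+q=k} H^{p,q}`, `H^{p,q}` = classes of closed
`(p,q)`-forms, which holds because `X^an ⊂ ℙᴺ(ℂ)` is compact Kähler. One `Prop` per `(n, X)`;
consumers take `(h : nonempty_hodgeModel n X)`. [cite: SerreGAGA1956, §2]
[cite: SGA1, Exp. XII Prop. 3.1 and Prop. 3.2] [cite: WellsDACM1980, Thm. III.4.13]
[cite: VoisinHodgeI2002, §3.3.2 and §6.1.3 Prop. 6.11] -/
def nonempty_hodgeModel : Prop :=
  Motives.IsSmoothProjective n X → Nonempty (HodgeModel n X)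

/-- Unfolding: the fact applied to a smooth projective `X` yields a Hodge model.
[cite: VoisinHodgeI2002, §6.1.3] -/
theorem nonempty_hodgeModel.nonempty (h : nonempty_hodgeModel n X) (hX : Motives.IsSmoothProjective n X) :
    Nonempty (HodgeModel n X) :=
  h hX

/-- With the fact, the Hodge conjecture for a smooth projective `X` is exactly its cycle part
"rational `(p,p)`-classes are algebraic" (the anti-vacuity conjunct of `HodgeConjectureFor` is
discharged). [cite: Deligne2000, §1] -/
theorem hodgeConjectureFor_iff_of_isSmoothProjective (h : nonempty_hodgeModel n X)
    (hX : Motives.IsSmoothProjective n X) :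
    HodgeConjectureFor n X ↔
      ∀ (p : ℕ) (c : Literature.AlgebraicTopology.SingularHomology.singularCohomology ℂ ℂ (Motives.ComplexPoints X) (2 * p)),
        IsRationalClass c → IsOfHodgeType n X (2 * p) p p c → c ∈ algebraicClasses X p := by
  obtain ⟨A⟩ := h hX
  exact hodgeConjectureFor_iff_of_hodgeModel A

/-- With the fact, every class of a smooth projective `X` lies in `F⁰ Hᵏ` (`F⁰ = Hᵏ`,
`HodgeModel.hodgeFiltration_zero`). [cite: VoisinHodgeI2002, §7.1.1] -/
theorem isInHodgeFiltration_zero_of_isSmoothProjective (h : nonempty_hodgeModel n X)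
    (hX : Motives.IsSmoothProjective n X) (k : ℕ) (c : Literature.AlgebraicTopology.SingularHomology.singularCohomology ℂ ℂ (Motives.ComplexPoints X) k) :
    IsInHodgeFiltration n X k 0 c :=
  (isInHodgeFiltration_zero_iff k c).2 (h hX)

/-- With the fact, `0` is of every Hodge type and in every `Fʳ` on a smooth projective `X`
(non-vacuity of the `∃`-over-models predicates). [cite: VoisinHodgeI2002, §7.1.1] -/
theorem isOfHodgeType_zero_of_isSmoothProjective (h : nonempty_hodgeModel n X)
    (hX : Motives.IsSmoothProjective n X) (k p q : ℕ) : IsOfHodgeType n X k p q 0 := by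
  obtain ⟨A⟩ := h hX
  exact IsOfHodgeType.zero A k p q

end HodgeTheory

end Literature.AlgebraicGeometry.HodgeTheory

end
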